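import Literature.NumberTheory.EllipticCurves.IsogenyPotentiallyGoodMinimalDiscriminant
import Literature.NumberTheory.EllipticCurves.IsogenyMultiplierDegreeProofs
import Literature.NumberTheory.EllipticCurves.IsogenyXFormulaTransportProofs
import Literature.NumberTheory.EllipticCurves.IsogenyCanonicalHeightProofs
import Literature.NumberTheory.EllipticCurves.IsogenyDualProofs
import Literature.NumberTheory.EllipticCurves.ShafarevichGoodReductionBadPlacesProofs
import Literature.NumberTheory.EllipticCurves.PotentialGoodReductionOddProofs
import Literature.NumberTheory.EllipticCurves.OpenImageMazurInertiaThreeProofs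
import Literature.NumberTheory.EllipticCurves.PotentialGoodReductionInertiaProofs
import Literature.NumberTheory.EllipticCurves.SemistableReductionBaseChange
import Literature.NumberTheory.EllipticCurves.QuadraticTwistKroneckerLFunctionProofs
import Literature.NumberTheory.EllipticCurves.CanonicalPAdicHeightRestrictionProofs
import Literature.NumberTheory.EllipticCurves.BSDConductorProofs
import Literature.NumberTheory.DiophantineGeometry.LocalReductionProofs
import Literature.NumberTheory.GaloisRepresentations.IntegralGaloisAction
import HarnessLib

/-!
# Dokchitser–Dokchitser 2015, Thm. 5.1 (1) (`l ≠ p`): an isogeny of degree prime to `p`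
# preserves `ord_p Δ_min` at a prime of potentially good reduction — DISCHARGE

`Proofs` file (theorems only: no definition, no named fact, no instance), topic
`NumberTheory/EllipticCurves`. Main result:
`Literature.NumberTheory.EllipticCurves.dokchitser_padicValInt_minimalDiscriminantInt_eq_of_isogeny_of_not_dvd_degree_holds`,
the discharge of the named fact of `IsogenyPotentiallyGoodMinimalDiscriminant.lean`
(T. Dokchitser, V. Dokchitser, *Local invariants of isogenous elliptic curves*, Trans. Amer. Math.
Soc. 367 (2015), Thm. 5.1 (1) = arXiv:1208.5519 Thm. 19 (1), with Table 1: for `W, W'/ℚ`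
globally minimal, `φ : W → W'` a `ℚ`-isogeny with `p ∤ deg φ` and `0 ≤ ord_p j(W)`,
`ord_p Δ_min(W) = ord_p Δ_min(W')`).

## The proof (the printed one, in the tree's vocabulary)

Dokchitser–Dokchitser: "`φ^*ω'/ω` is unchanged by base change to any `F/K`; over a field `F` where
`E` has good reduction both minimal discriminants are units, and the claim for `E/F` implies that
for `E/K`". Here:

1. *The good-reduction field.* `0 ≤ ord_p j` gives `|j|_v ≤ 1` at the place `v ∣ p` of `ℚ`; over
   the finite Galois extension `F = ℚ(W[3])` (or `ℚ(W[4])` when `p = 3`) `W` has good reduction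
   at every `w ∣ v` (Silverman *ATAEC* IV.10.3(b), the tree's
   `hasGoodReductionAt_baseChange_of_forall_smul_geomTorsion_three_eq` / `…_four_eq`), hence so
   has `W'` (*AEC* VII.7.2, `Isogeny.hasGoodReductionAt_of_hasGoodReductionAt` applied to the dual
   isogeny over `F`); `F`-rational models `C • W_F`, `C' • W'_F` minimal at `w`
   (`exists_variableChange_isMinimalAt_dedekind`) have `w`-unit discriminants, so
   `w(Δ_W) = w(u)¹²`, `w(Δ_{W'}) = w(u')¹²`.
2. *The Néron mapping property.* The multiplier of a `ℚ`-isogeny between globally minimal models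
   is an integer `k ∣ deg φ` (`Isogeny.exists_int_multiplier_dvd_degree`), so `w(k) = 1`; the
   transported isogeny `C • W_F → C' • W'_F` has multiplier `k u'/u`
   (`Isogeny.exists_x_formula_smul_extendScalars`), which is `w`-integral by the tree's
   `IsDedekindDomain.HeightOneSpectrum.valuation_multiplier_le_one` (target minimal at `w`). Hence
   `w(u') ≤ w(u)`, i.e. `ord_p Δ_min(W) ≤ ord_p Δ_min(W')`
   (`padicValInt_minimalDiscriminantInt_le_of_isogeny_of_isMinimalAt`).
3. The dual isogeny `φ̂` (`deg φ̂ = deg φ`, `Isogeny.degree_eq_of_comp_eq_degree_smul`) gives the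
   reverse inequality.

No Néron models, no Tate's algorithm: the two printed black boxes (Néron mapping property;
potential good reduction) are the tree's theorems quoted above.

References: [DokchitserDokchitser2015LocalInvariants] Thm. 5.1 (1), Table 1;
[SilvermanAEC2009] Prop. VII.5.5, Cor. VII.7.2, III.6; [SilvermanATAEC1994] IV.5.1, IV.6.1,
Cor. IV.9.1, Prop. IV.10.3.
-/

noncomputable section

open scoped Classical

/-! ## Valuations at a place above `p` and the one-sided inequality -/

namespace Literature.NumberTheory.EllipticCurves

open _root_.WeierstrassCurve _root_.IsDedekindDomain _root_.NumberField _root_.Polynomial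

section Valuation

variable {F : Type} [Field F] [NumberField F]

/-- At a place `w ∣ p`, a nonzero rational `q` with `ord_p q = m ∈ ℕ` has `w(q) = w(p)^m`.
[folklore] -/
private theorem valuation_ratCast_eq_pow_of_padicValRat_eq (w : HeightOneSpectrum (𝓞 F)) {p : ℕ}
    (hp : p.Prime) (hpw : (p : 𝓞 F) ∈ w.asIdeal) {q : ℚ} (hq : q ≠ 0) {m : ℕ}
    (hm : padicValRat p q = m) :
    w.valuation F (q : F) = w.valuation F (p : F) ^ m := by
  haveI := Fact.mk hp
  have hp0 : (p : ℚ) ≠ 0 := by exact_mod_cast hp.ne_zero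
  have hq' : padicValRat p (q / (p : ℚ) ^ m) = 0 := by
    rw [padicValRat.div hq (pow_ne_zero _ hp0), padicValRat.pow, padicValRat.self hp.one_lt, hm,
      mul_one, sub_self]
  have h1 := valuation_ratCast_eq_one_of_padicValRat_eq_zero (v := w) hp hpw
    (div_ne_zero hq (pow_ne_zero _ hp0)) hq'
  have : (q : F) = ((q / (p : ℚ) ^ m : ℚ) : F) * (p : F) ^ m := by
    have hpF0 : (p : F) ≠ 0 := by exact_mod_cast hp.ne_zero
    push_cast
    field_simp
  rw [this, map_mul, h1, one_mul, map_pow]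

/-- At a place `w ∣ p`: `0 < w(p) < 1`. [folklore] -/
private theorem valuation_natCast_pos_lt_one (w : HeightOneSpectrum (𝓞 F)) {p : ℕ} (hp : p.Prime)
    (hpw : (p : 𝓞 F) ∈ w.asIdeal) :
    0 < w.valuation F (p : F) ∧ w.valuation F (p : F) < 1 := by
  refine ⟨?_, ?_⟩
  · exact (Valuation.pos_iff _).mpr (by exact_mod_cast hp.ne_zero)
  · have : (p : F) = algebraMap (𝓞 F) F (p : 𝓞 F) := by simp
    rw [this, HeightOneSpectrum.valuation_lt_one_iff_mem]
    exact hpw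

/-- **The `p`-adic valuation of the minimal discriminant read at a place `w ∣ p` of a finite
extension**: for a globally minimal `W/ℚ`, `w(Δ_min(W)) = w(p)^{ord_p Δ_min(W)}`. [folklore] -/
private theorem valuation_minimalDiscriminantInt (W : WeierstrassCurve ℚ) [W.IsElliptic]
    [W.IsGloballyMinimal] (w : HeightOneSpectrum (𝓞 F)) {p : ℕ} (hp : p.Prime)
    (hpw : (p : 𝓞 F) ∈ w.asIdeal) :
    w.valuation F (W.Δ : F) =
      w.valuation F (p : F) ^ padicValInt p W.minimalDiscriminantInt := by
  have hΔ : (W.minimalDiscriminantInt : ℚ) = W.Δ := W.cast_minimalDiscriminantInt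
  have hΔ0 : W.minimalDiscriminantInt ≠ 0 := W.minimalDiscriminantInt_ne_zero
  have hq : (W.Δ : ℚ) ≠ 0 := by rw [← hΔ]; exact_mod_cast hΔ0
  refine valuation_ratCast_eq_pow_of_padicValRat_eq w hp hpw hq ?_
  rw [← hΔ, padicValRat.of_int]

end Valuation

section OneSided

open Literature.NumberTheory.GaloisRepresentations

/-- **One-sided form of Dokchitser–Dokchitser 2015, Thm. 5.1 (1) (`l ≠ p`).** Let `φ : W → W'` be
a `ℚ`-isogeny of degree prime to `p` between globally minimal elliptic curves, `F/ℚ` a finite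
extension (inside `ℚ̄`), `w ∣ p` a place of `F`, and `C • W_F`, `C' • W'_F` models MINIMAL at `w`
with `w`-UNIT discriminants (good reduction). Then `ord_p Δ_min(W) ≤ ord_p Δ_min(W')`. Proof: the
multiplier of `ι_{C'} ∘ φ_F ∘ ι_C⁻¹` is `k u'/u` with `k ∈ ℤ`, `k ∣ deg φ` (so `w(k) = 1`), and it is
`w`-integral (`valuation_multiplier_le_one`, the tree's Néron-mapping-property substitute); hence
`w(u') ≤ w(u)`, and `w(Δ_W) = w(u)¹²`, `w(Δ_{W'}) = w(u')¹²` by the unit discriminants.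
[cite: DokchitserDokchitser2015LocalInvariants, Thm. 5.1 (1) and Table 1 (φ^*ω'/ω = 1)]
[cite: SilvermanATAEC1994, IV.5.1 with IV.6.1 and Cor. IV.9.1] -/
theorem padicValInt_minimalDiscriminantInt_le_of_isogeny_of_isMinimalAt
    {W W' : WeierstrassCurve ℚ} [W.IsElliptic] [W'.IsElliptic] [W.IsGloballyMinimal]
    [W'.IsGloballyMinimal] (φ : Isogeny W W') {p : ℕ} (hp : p.Prime) (hpd : ¬ p ∣ φ.degree)
    (F : IntermediateField ℚ (AlgebraicClosure ℚ)) [FiniteDimensional ℚ F] [NumberField F]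
    (w : HeightOneSpectrum (𝓞 F)) (hpw : (p : 𝓞 F) ∈ w.asIdeal) (C C' : VariableChange F)
    (hC : (C • W.baseChange F).IsMinimalAt w) (hC' : (C' • W'.baseChange F).IsMinimalAt w)
    (hΔ : w.valuation F (C • W.baseChange F).Δ = 1)
    (hΔ' : w.valuation F (C' • W'.baseChange F).Δ = 1) :
    padicValInt p W.minimalDiscriminantInt ≤ padicValInt p W'.minimalDiscriminantInt := by
  classical
  haveI := Fact.mk hp
  haveI : (W.baseChange F).IsElliptic := inferInstanceAs (W.map (algebraMap ℚ F)).IsElliptic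
  haveI : (W'.baseChange F).IsElliptic := inferInstanceAs (W'.map (algebraMap ℚ F)).IsElliptic
  -- the multiplier `k ∈ ℤ`, `k ∣ deg φ`, and the `x`-formula
  obtain ⟨k, hk0, hkd, A, B, hBm, hdeg, hlc, hform⟩ := φ.exists_int_multiplier_dvd_degree
  have hpk : ¬ (p : ℤ) ∣ k := fun h ↦ hpd (by
    have := dvd_trans h hkd
    exact_mod_cast Int.natCast_dvd_natCast.mp (by exact_mod_cast this))
  have hwk : w.valuation F ((k : ℚ) : F) = 1 := by
    refine valuation_ratCast_eq_one_of_padicValRat_eq_zero (v := w) hp hpw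
      (by exact_mod_cast hk0) ?_
    rw [padicValRat.of_int, padicValInt.eq_zero_of_not_dvd hpk, Nat.cast_zero]
  -- the transported isogeny between the minimal models and its multiplier
  obtain ⟨Φ, A', B', Bad, hBad, hB'm, hdeg', hlc', hform'⟩ :=
    φ.exists_x_formula_smul_extendScalars hBm hdeg hlc hform F C C'
  haveI : ((C • W.baseChange F).baseChange (w.adicCompletion F)).IsMinimal
      (w.adicCompletionIntegers F) := hC
  haveI : ((C' • W'.baseChange F).baseChange (w.adicCompletion F)).IsMinimal
      (w.adicCompletionIntegers F) := hC'
  set c : F := algebraMap ℚ F k * (C'.u : F) * (C.u : F)⁻¹ with hc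
  have hkF : algebraMap ℚ F (k : ℚ) = ((k : ℚ) : F) := by rw [eq_ratCast]
  have hkF0 : algebraMap ℚ F (k : ℚ) ≠ 0 := by
    rw [hkF]; exact_mod_cast hk0
  have hc0 : c ≠ 0 := mul_ne_zero (mul_ne_zero hkF0 C'.u.ne_zero) (inv_ne_zero C.u.ne_zero)
  have hval : w.valuation F c ≤ 1 :=
    HeightOneSpectrum.valuation_multiplier_le_one w (C • W.baseChange F) (C' • W'.baseChange F)
      Φ hc0 hBad hB'm hdeg' hlc' hform'
  -- `w(u') ≤ w(u)`
  have hu0 : w.valuation F (C.u : F) ≠ 0 := (Valuation.ne_zero_iff _).mpr C.u.ne_zero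
  have hu'le : w.valuation F (C'.u : F) ≤ w.valuation F (C.u : F) := by
    rw [hc, map_mul, map_mul, map_inv₀, hkF, hwk, one_mul] at hval
    rwa [mul_inv_le_iff₀ (zero_lt_iff.mpr hu0), one_mul] at hval
  -- `w(Δ_W) = w(u)¹²`, `w(Δ_{W'}) = w(u')¹²`
  have hΔu : ∀ (V : WeierstrassCurve ℚ) (D : VariableChange F),
      w.valuation F (D • V.baseChange F).Δ = 1 →
      w.valuation F (V.Δ : F) = w.valuation F (D.u : F) ^ 12 := by
    intro V D h
    have hD0 : w.valuation F (D.u : F) ≠ 0 := (Valuation.ne_zero_iff _).mpr D.u.ne_zero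
    rw [variableChange_Δ, WeierstrassCurve.baseChange, map_Δ, eq_ratCast, map_mul, map_pow,
      Units.val_inv_eq_inv_val, map_inv₀] at h
    rwa [inv_pow, inv_mul_eq_one₀ (pow_ne_zero _ hD0), eq_comm] at h
  have h1 : w.valuation F (W'.Δ : F) ≤ w.valuation F (W.Δ : F) := by
    rw [hΔu W C hΔ, hΔu W' C' hΔ']
    exact pow_le_pow_left₀ zero_le hu'le 12
  -- translate to `ord_p`
  rw [valuation_minimalDiscriminantInt W w hp hpw, valuation_minimalDiscriminantInt W' w hp hpw] at h1
  obtain ⟨hp0, hp1⟩ := valuation_natCast_pos_lt_one w hp hpw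
  rwa [pow_le_pow_iff_right_of_lt_one₀ hp0 hp1] at h1

end OneSided

/-! ## The discharge -/

section Discharge

open Literature.NumberTheory.GaloisRepresentations

/-- **Dokchitser–Dokchitser 2015, Thm. 5.1 (1), clause `l ≠ p` — DISCHARGED.** For globally
minimal elliptic curves `W, W'/ℚ`, a `ℚ`-isogeny `φ : W → W'` of degree prime to `p` and `W`
potentially good at `p` (`0 ≤ ord_p j(W)`): `ord_p Δ_min(W) = ord_p Δ_min(W')`. Proof (the
printed one, T. & V. Dokchitser, Trans. AMS 367 (2015) Thm. 5.1 (1): "over a field `F` where `E`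
has good reduction both minimal discriminants are units", with the Néron mapping property read as
the integrality of the multiplier): over the finite Galois extension `F = ℚ(E[3])` (resp.
`ℚ(E[4])` at `p = 3`) the curve acquires good reduction at every `w ∣ p`
(`hasGoodReductionAt_baseChange_of_forall_smul_geomTorsion_three_eq` / `…four_eq`, Silverman
*ATAEC* IV.10.3), and so does `W'` (`Isogeny.hasGoodReductionAt_of_hasGoodReductionAt`, *AEC*
VII.7.2, applied to the dual isogeny); take `F`-models minimal at `w`
(`exists_variableChange_isMinimalAt_dedekind`); then
`padicValInt_minimalDiscriminantInt_le_of_isogeny_of_isMinimalAt` for `φ` and for the dual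
isogeny `φ̂` (`deg φ̂ = deg φ`) gives the two inequalities.
[cite: DokchitserDokchitser2015LocalInvariants, Thm. 5.1 (1) (arXiv:1208.5519 Thm. 19 (1)) with Table 1]
[cite: SilvermanAEC2009, Cor. VII.7.2 and Prop. VII.5.5] -/
theorem dokchitser_padicValInt_minimalDiscriminantInt_eq_of_isogeny_of_not_dvd_degree_holds :
    dokchitser_padicValInt_minimalDiscriminantInt_eq_of_isogeny_of_not_dvd_degree := by
  intro W W' _ _ _ _ φ p hp hpd hj
  classical
  haveI := Fact.mk hp
  -- the place of `ℚ` above `p` and `ord_v j ≥ 0`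
  set v₀ : HeightOneSpectrum (𝓞 ℚ) := (Rat.HeightOneSpectrum.primesEquiv (R := 𝓞 ℚ)).symm ⟨p, hp⟩
    with hv₀
  have hpv₀ : (p : 𝓞 ℚ) ∈ v₀.asIdeal :=
    (natCast_mem_asIdeal_iff_eq_primesEquiv_symm v₀ hp).mpr hv₀
  have hqv₀ : ∀ {q : ℕ}, q.Prime → q ≠ p → (q : 𝓞 ℚ) ∉ v₀.asIdeal := by
    intro q hq hqp hmem
    have h := (natCast_mem_asIdeal_iff_eq_primesEquiv_symm v₀ hq).mp hmem
    rw [hv₀, Equiv.apply_eq_iff_eq] at h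
    exact hqp (congrArg (fun x : Nat.Primes ↦ (x : ℕ)) h).symm
  have hjv : v₀.valuation ℚ W.j ≤ 1 := by
    by_cases hj0 : W.j = 0
    · rw [hj0, map_zero]; exact zero_le
    · obtain ⟨m, hm⟩ := Int.eq_ofNat_of_zero_le hj
      have h := valuation_ratCast_eq_pow_of_padicValRat_eq (F := ℚ) v₀ hp hpv₀ hj0 hm
      rw [Rat.cast_id] at h
      rw [h]
      exact pow_le_one₀ zero_le (valuation_natCast_pos_lt_one v₀ hp hpv₀).2.le
  -- a finite Galois `F/ℚ` over which `W` has good reduction above `p`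
  obtain ⟨F, hfin, hgal, hnf, hgood⟩ : ∃ (F : IntermediateField ℚ (AlgebraicClosure ℚ))
      (_ : FiniteDimensional ℚ F) (_ : IsGalois ℚ F) (_ : NumberField F),
      ∀ w : HeightOneSpectrum (𝓞 F), w.asIdeal.under (𝓞 ℚ) = v₀.asIdeal →
        (W.baseChange F).HasGoodReductionAt w := by
    by_cases h3 : p = 3
    · have h2 : (2 : 𝓞 ℚ) ∉ v₀.asIdeal := by
        simpa using hqv₀ Nat.prime_two (by rw [h3]; decide)
      exact W.exists_isGalois_hasGoodReductionAt_baseChange_of_valuation_j_le_one_of_notMem_two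
        v₀ hjv h2
    · have h3' : (3 : 𝓞 ℚ) ∉ v₀.asIdeal := by
        simpa using hqv₀ Nat.prime_three (fun h ↦ h3 h.symm)
      obtain ⟨F, hfin, hgal, hF⟩ := W.exists_isGalois_forall_smul_geomTorsion_eq (m := 3)
        three_ne_zero
      haveI := hfin
      haveI := hgal
      haveI : NumberField F := NumberField.of_module_finite ℚ F
      exact ⟨F, hfin, hgal, inferInstance, fun w hw ↦
        W.hasGoodReductionAt_baseChange_of_forall_smul_geomTorsion_three_eq F hF h3' hjv hw⟩
  haveI := hfin
  haveI := hgal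
  haveI := hnf
  haveI : (W.baseChange F).IsElliptic := inferInstanceAs (W.map (algebraMap ℚ F)).IsElliptic
  haveI : (W'.baseChange F).IsElliptic := inferInstanceAs (W'.map (algebraMap ℚ F)).IsElliptic
  -- a place `w ∣ v₀` of `F`
  obtain ⟨𝔓, h𝔓⟩ := v₀.primesAbove_nonempty
  obtain ⟨w, -, hw, -, -⟩ := exists_primesAbove_mem_inertia_iff ℚ F h𝔓
  have hpw : (p : 𝓞 F) ∈ w.asIdeal := by
    have : (p : 𝓞 F) = algebraMap (𝓞 ℚ) (𝓞 F) p := by simp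
    rw [this, ← Ideal.mem_comap, ← Ideal.under_def, hw]
    exact hpv₀
  -- good reduction of `W_F` and `W'_F` at `w`
  have hgW : (W.baseChange F).HasGoodReductionAt w := hgood w hw
  obtain ⟨ψ, hψ⟩ := φ.exists_dual_of_isElliptic
  have hdegψ : ψ.degree = φ.degree := Isogeny.degree_eq_of_comp_eq_degree_smul φ ψ hψ
  have hgW' : (W'.baseChange F).HasGoodReductionAt w :=
    (ψ.extendScalars F).hasGoodReductionAt_of_hasGoodReductionAt hgW
  -- minimal models at `w`
  obtain ⟨C, hC⟩ := exists_variableChange_isMinimalAt_dedekind (W.baseChange F) w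
  obtain ⟨C', hC'⟩ := exists_variableChange_isMinimalAt_dedekind (W'.baseChange F) w
  have hΔ : w.valuation F (C • W.baseChange F).Δ = 1 :=
    (hasGoodReductionAt_iff_of_isMinimalAt hC).mp
      ((hasGoodReductionAt_smul_iff_holds w (W.baseChange F) C).mpr hgW)
  have hΔ' : w.valuation F (C' • W'.baseChange F).Δ = 1 :=
    (hasGoodReductionAt_iff_of_isMinimalAt hC').mp
      ((hasGoodReductionAt_smul_iff_holds w (W'.baseChange F) C').mpr hgW')
  -- the two inequalities
  have h1 := padicValInt_minimalDiscriminantInt_le_of_isogeny_of_isMinimalAt φ hp hpd F w hpw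
    C C' hC hC' hΔ hΔ'
  have h2 := padicValInt_minimalDiscriminantInt_le_of_isogeny_of_isMinimalAt ψ hp
    (by rwa [hdegψ]) F w hpw C' C hC' hC hΔ' hΔ
  exact le_antisymm h1 h2

end Discharge

end Literature.NumberTheory.EllipticCurves

end
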